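import Mathlib
import Summits.Ventures.PercRepro2.SepSplitChainSingle
import Summits.Ventures.PercRepro2.SepSplitFrozenMarks

/-!
# Gluing at a general separator, XIII: the DEAD orbits and the rule on the LIVE ones (blind cell
PercRepro2, mine-2 g49, 2026-08-29; `conjectures/MINE-2.md` M2-102)

The vanishing theorems of `SepSplitFrozen`, `SepSplitFrozenMarks` and `SepSplitChainSingle` are
collected into one predicate on far data triples, `Dead side p`: a root or a mark among
`a₁, a₂, o, b` behind the separator, off it in all three far data with one and the same frozen
status (`FrozenA1 / FrozenA2 / FrozenO / FrozenB`); or, with both roots behind the separator, a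
far datum joining them (`Joined`) or a chain-single triple (`ChainSingle`).  Every dead triple has
orbit sum ZERO on every root side (`orbitRootS_eq_zero_of_dead`), so the realised-orbit rule of
`SepSplitRule` needs the sign of the LIVE realised orbits only
(`typedCount_nonneg_of_sepSplit_realised_live`) and the equality locus of `SepSplitLocus` reads on
them (`typedCount_eq_zero_iff_of_sepSplit_live`).  The always-zero-orbit census of M2-102 (kit
j333312) is the numerical twin: on the sampled root sides the dead orbits are exactly the orbits
never nonzero.  Own work; standard axioms.
-/

namespace Summit.Ventures.PercRepro2

open UnionCluster

namespace CovForm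

namespace RootBridge

open OneTyped TypedA3 Untouched TypedFactor Separated

/-! ## The dead triples -/

section Dead

variable {ι : Type*}

/-- `a₂` off the separator in the three far data with one and the same frozen status. -/
def FrozenA2 (side : Fin 5 → Bool) (p : Pat3S ι) : Prop :=
  (OffSep p.1 2 ∧ OffSep p.2.1 2 ∧ OffSep p.2.2 2) ∧
    (frozenH side p.1 = frozenH side p.2.2 ∧ frozenH side p.2.1 = frozenH side p.2.2)

/-- `a₁` off the separator in the three far data with one and the same frozen status. -/
def FrozenA1 (side : Fin 5 → Bool) (p : Pat3S ι) : Prop :=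
  (OffSep p.1 1 ∧ OffSep p.2.1 1 ∧ OffSep p.2.2 1) ∧
    (frozenL side p.1 = frozenL side p.2.2 ∧ frozenL side p.2.1 = frozenL side p.2.2)

/-- `o` off the separator in the three far data with one and the same frozen status. -/
def FrozenO (side : Fin 5 → Bool) (p : Pat3S ι) : Prop :=
  (OffSep p.1 0 ∧ OffSep p.2.1 0 ∧ OffSep p.2.2 0) ∧
    (frozenO side p.1 = frozenO side p.2.2 ∧ frozenO side p.2.1 = frozenO side p.2.2)

/-- `b` off the separator in the three far data with one and the same frozen status. -/
def FrozenB (side : Fin 5 → Bool) (p : Pat3S ι) : Prop :=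
  (OffSep p.1 4 ∧ OffSep p.2.1 4 ∧ OffSep p.2.2 4) ∧
    (frozenB side p.1 = frozenB side p.2.2 ∧ frozenB side p.2.1 = frozenB side p.2.2)

/-- A far datum of the triple joins `a₂` to `a₁`. -/
def Joined (p : Pat3S ι) : Prop :=
  p.1.1 2 1 = true ∨ p.2.1.1 2 1 = true ∨ p.2.2.1 2 1 = true

/-- **The dead triples**: a frozen root or mark behind the separator, or — with both roots behind
it — a joining datum or a chain-single triple. -/
def Dead (side : Fin 5 → Bool) (p : Pat3S ι) : Prop :=
  (side 2 = true ∧ FrozenA2 side p) ∨ (side 1 = true ∧ FrozenA1 side p) ∨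
    (side 0 = true ∧ FrozenO side p) ∨ (side 4 = true ∧ FrozenB side p) ∨
    (side 1 = true ∧ side 2 = true ∧ (Joined p ∨ ChainSingle side p))

end Dead

/-! ## Dead triples have zero orbit sum -/

section Vanish

open Classical

variable {V : Type*} {E : Type*} {ι : Type*} [Fintype E] [DecidableEq E] {R : Type*} [Field R]
variable (ends : E → Sym2 V) (mk : Fin 5 → V) (σ : ι → V)

/-- **Every dead triple has orbit sum zero** on every root side (types in `{1, 2}`), realised or
not. -/
theorem orbitRootS_eq_zero_of_dead (side : Fin 5 → Bool) (VH : Set V) (B : Finset E)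
    (z : Config E) (τ : E → ℕ) (hτ : ∀ e ∈ B, τ e = 1 ∨ τ e = 2) (p : Pat3S ι)
    (hd : Dead side p) : orbitRootS ends mk σ side VH B z τ p = (0 : R) := by
  rcases hd with ⟨h2, hoff, hsame⟩ | ⟨h1, hoff, hsame⟩ | ⟨h0, hoff, hsame⟩ | ⟨h4, hoff, hsame⟩ |
    ⟨h1, h2, hj | hcs⟩
  · exact orbitRootS_eq_zero_of_offSep_a2 ends mk σ side h2 VH B z τ hτ p hoff hsame
  · exact orbitRootS_eq_zero_of_offSep_a1 ends mk σ side h1 VH B z τ hτ p hoff hsame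
  · exact orbitRootS_eq_zero_of_offSep_o ends mk σ side h0 VH B z τ hτ p hoff hsame
  · exact orbitRootS_eq_zero_of_offSep_b ends mk σ side h4 VH B z τ hτ p hoff hsame
  · exact orbitRootS_eq_zero_of_joined ends mk σ side h1 h2 VH B z τ p hj
  · exact orbitRootS_eq_zero_of_chainSingle ends mk σ side h1 h2 VH B z τ hτ p hcs

end Vanish

/-! ## The rule and the equality locus on the live orbits -/

section Live

open Classical

variable {V : Type*} {E : Type*} {ι : Type*} [Fintype E] [DecidableEq E] [Fintype ι]
  [DecidableEq ι] {R : Type*} [Field R] [LinearOrder R] [IsStrictOrderedRing R]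
variable (ends : E → Sym2 V) (mk : Fin 5 → V) (σ : ι → V)

/-- **Row 2′TRI at any split, from the realised LIVE orbits**: it suffices that the orbit sums of
the glued root counts be nonnegative on the realised triples that are not dead. -/
theorem typedCount_nonneg_of_sepSplit_realised_live {side : Fin 5 → Bool} {VL VH : Set V}
    (F : Finset E) (z : Config E) (τ : E → ℕ) (hτ : ∀ e ∈ F, τ e = 1 ∨ τ e = 2)
    (h : SepSplit ends mk σ side VL VH F z)
    (hroot : ∀ p : Pat3S ι,
      typedCount (sideF ends VL F) z τ
          (farKS ends mk σ VL p : Config E → Config E → Config E → R) ≠ 0 →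
      ¬ Dead side p → (0 : R) ≤ orbitRootS ends mk σ side VH (sideF ends VH F) z τ p) :
    0 ≤ typedCount F z τ
      (K3 ends (mk 0) (mk 1) (mk 2) (mk 3) (mk 4) : Config E → Config E → Config E → R) := by
  refine typedCount_nonneg_of_sepSplit_realised ends mk σ F z τ hτ h fun p hp => ?_
  by_cases hd : Dead side p
  · exact (orbitRootS_eq_zero_of_dead ends mk σ side VH (sideF ends VH F) z τ
      (fun e he => hτ e (Finset.filter_subset _ _ he)) p hd).ge
  · exact hroot p hp hd

/-- **The equality locus at any split, on the live orbits** (under the sign hypothesis on the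
realised live orbits): `N = 0` ⟺ every realised live orbit sum is `0`. -/
theorem typedCount_eq_zero_iff_of_sepSplit_live {side : Fin 5 → Bool} {VL VH : Set V}
    (F : Finset E) (z : Config E) (τ : E → ℕ) (hτ : ∀ e ∈ F, τ e = 1 ∨ τ e = 2)
    (h : SepSplit ends mk σ side VL VH F z)
    (hroot : ∀ p : Pat3S ι,
      typedCount (sideF ends VL F) z τ
          (farKS ends mk σ VL p : Config E → Config E → Config E → R) ≠ 0 →
      ¬ Dead side p → (0 : R) ≤ orbitRootS ends mk σ side VH (sideF ends VH F) z τ p) :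
    typedCount F z τ
        (K3 ends (mk 0) (mk 1) (mk 2) (mk 3) (mk 4) : Config E → Config E → Config E → R) = 0 ↔
      ∀ p : Pat3S ι,
        typedCount (sideF ends VL F) z τ
            (farKS ends mk σ VL p : Config E → Config E → Config E → R) ≠ 0 →
          ¬ Dead side p → orbitRootS ends mk σ side VH (sideF ends VH F) z τ p = (0 : R) := by
  have hτB : ∀ e ∈ sideF ends VH F, τ e = 1 ∨ τ e = 2 :=
    fun e he => hτ e (Finset.filter_subset _ _ he)
  have hroot' : ∀ p : Pat3S ι,
      typedCount (sideF ends VL F) z τ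
          (farKS ends mk σ VL p : Config E → Config E → Config E → R) ≠ 0 →
      (0 : R) ≤ orbitRootS ends mk σ side VH (sideF ends VH F) z τ p := fun p hp => by
    by_cases hd : Dead side p
    · exact (orbitRootS_eq_zero_of_dead ends mk σ side VH (sideF ends VH F) z τ hτB p hd).ge
    · exact hroot p hp hd
  rw [typedCount_eq_zero_iff_of_sepSplit ends mk σ F z τ hτ h hroot']
  constructor
  · intro hz p hp _
    exact hz p hp
  · intro hz p hp
    by_cases hd : Dead side p
    · exact orbitRootS_eq_zero_of_dead ends mk σ side VH (sideF ends VH F) z τ hτB p hd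
    · exact hz p hp hd

end Live

end RootBridge

end CovForm

end Summit.Ventures.PercRepro2
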